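import Mathlib.LinearAlgebra.FreeModule.Finite.CardQuotient
import Mathlib.LinearAlgebra.FreeModule.PID
import Mathlib.LinearAlgebra.Matrix.AbsoluteValue
import Mathlib.GroupTheory.Index
import Mathlib.Algebra.Module.Submodule.Pointwise
import Mathlib.Algebra.Algebra.Operations
import Mathlib.Algebra.Module.Torsion.Free
import Mathlib.Algebra.GroupWithZero.Subgroup
import Mathlib.Data.Fintype.Pigeonhole
import Mathlib.Data.Nat.Factorial.Basic
import Mathlib.RingTheory.DedekindDomain.Ideal.Basic
import Mathlib.RingTheory.ClassGroup.Basic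
import Mathlib.Data.Matrix.Basic
import Mathlib.Data.Matrix.Mul
import Mathlib.LinearAlgebra.Matrix.Notation
import Mathlib.Tactic.FieldSimp
import Mathlib.RingTheory.SimpleModule.WedderburnArtin
import Mathlib.RingTheory.Artinian.Module
import Mathlib.LinearAlgebra.Dimension.FreeAndStrongRankCondition
import Mathlib.NumberTheory.NumberField.Basic
import Mathlib.NumberTheory.NumberField.ClassNumber
import Mathlib.RingTheory.Ideal.Norm.AbsNorm
import Literature.NumberTheory.Automorphic.QuaternionAlgebraAdelic
import HarnessLib

/-!
# The Jordan–Zassenhaus theorem for `ℤ`-orders in quaternion algebras over number fields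

Let `D` be a quaternion algebra over a number field `K` and `Λ ⊆ D` a `ℤ`-order (a full
`ℤ`-lattice containing `1` and closed under multiplication). The **Jordan–Zassenhaus theorem**
(Zassenhaus 1938; Swan–Evans, *K-theory of finite groups and orders*, LNM 149 (1970), Ch. 3,
Thm. 3.9 (for `ℤ`), Cor. 3.10, Lemma 3.11; Reiner, *Maximal Orders*, §26 (26.4)) says that the
full right `Λ`-lattices `M ⊆ D` (`M Λ ⊆ M`) fall into finitely many orbits under left
multiplication by `Dˣ` — classically, the finiteness of the number of classes of right ideals of
an order (Vignéras, LNM 800, III §5 Thm. 5.4). This file **proves** it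
(`hasFiniteClassSet_of_isQuaternionAlgebra`), sorry-free, following the architecture of Swan's
proof of Thm. 3.9:

1. *Change of order* (Swan–Evans Lemma 3.11, `HasFiniteClassSet.of_smul_mem`,
   `HasFiniteClassSet.of_order`): the property passes between commensurable orders, using the
   finiteness of the windows `n N ⊆ P ⊆ N` (`finite_setOf_le_and_smul_mem`).
2. *Wedderburn dichotomy* (`forall_isUnit_or_nonempty_algEquiv_matrix`): a quaternion algebra is
   a division algebra or `≅ M₂(K)` (Mathlib's Wedderburn–Artin).
3. *Division case* (the last step of Swan's proof of Thm. 3.9 for `R = ℤ`,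
   `hasFiniteClassSet_of_forall_isUnit`): for `M ⊆ Λ` choose `k` with `kⁿ ≤ [Λ : M] < (k+1)ⁿ`;
   the pigeonhole principle gives `0 ≠ z ∈ M` with coordinates `≤ k` in a `ℤ`-basis of `Λ`;
   `[Λ : zΛ] = |det(x ↦ zx)| ≤ C kⁿ` (Mathlib `Submodule.natAbs_det_equiv`, `Matrix.det_sum_smul_le`),
   so `[M : zΛ] ≤ C`, and `r z⁻¹ M` (`r = C!`) lies in the finite window `r Λ ⊆ · ⊆ Λ`.
4. *Split case* (`hasFiniteClassSet_matrixOrder`, Swan's Morita step done by hand, then Steinitz):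
   a right `M₂(R)`-lattice is `[P | P]` for an `R`-lattice `P ⊆ K²` (`mem_iff_forall_col_mem`);
   `P = g (𝔞 ⊕ 𝔟)` with `g ∈ GL₂(K)` upper triangular, from a section of `P → 𝔟`
   (`𝔟` the second-coordinate ideal) built out of `𝔟 𝔟⁻¹ = R` (`exists_section`, `exists_sigma`, `mem_iff_coords`); and
   `𝔞 = t₁ J_{c₁}`, `𝔟 = t₂ J_{c₂}` for representatives `J_c` of the finitely many ideal classes
   (`exists_eq_smul_repIdeal`, Mathlib `ClassGroup.mk0_eq_mk0_iff` and the finiteness of the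
   class group of `𝓞_K`). Hence at most `h_K²` classes for the order `M₂(𝓞_K)`.
5. *Transport and assembly* (`HasFiniteClassSet.of_ringEquiv`,
   `hasFiniteClassSet_of_isQuaternionAlgebra`).

Also here (moved from the class-number file, which imports this one): the notion of a full
`ℤ`-lattice `IsFullLattice`, `mem_units_smul_submodule_iff`, and `exists_natCast_eq_mul`.

Design: everything is over `ℤ` (`Submodule ℤ D`, integer denominators), which is what the adelic
lattice dictionary of `QuaternionicFormsClassNumber` produces; the split case is proved for any
Dedekind domain `R` with finite class group, finite over `ℤ`, whose fraction field `K` has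
characteristic zero and `ℤ`-denominators, and specialised to `R = 𝓞_K`.

## References

* R. G. Swan (notes by E. G. Evans), *K-theory of finite groups and orders*, LNM 149 (1970),
  Ch. 3: Lemma 3.7, Thm. 3.9, Cor. 3.10, Lemma 3.11.
* I. Reiner, *Maximal Orders* (1975/2003), §26, Thm. (26.4).
* H. Zassenhaus, *Neuer Beweis der Endlichkeit der Klassenzahl bei unimodularer Äquivalenz
  endlicher ganzzahliger Substitutionsgruppen*, Abh. Math. Sem. Hamburg 12 (1938).
* M.-F. Vignéras, *Arithmétique des algèbres de quaternions*, LNM 800 (1980), III §5 Thm. 5.4.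
-/

noncomputable section

open scoped Pointwise nonZeroDivisors
open NumberField

universe u v

namespace Literature.NumberTheory.Automorphic

variable (D : Type u) [Ring D]

/-- A **full `ℤ`-lattice** in a ring `D` (a "full `R`-lattice" in the sense of Reiner, *Maximal
Orders* §2, or Swan–Evans, *K-theory of finite groups and orders*, Ch. 3: a finitely generated
`R`-module `M ⊆ A` with `K M = A`, here `R = ℤ`; Weil's "`Q`-lattice", BNT Ch. V §2): a finitely
generated additive subgroup `M ⊆ D` such that every element of `D` has a nonzero integral multiple
in `M` (`ℚ · M = D`). Full `𝓞_K`-lattices (Weil's `k`-lattices, BNT V §2 Def. 3) are the full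
`ℤ`-lattices that are `𝓞_K`-stable. (Mathlib's `Submodule.IsLattice ℚ M` says the same once `D` is
given a `ℚ`-module structure, which a bare ring `D` does not carry; `Submodule.IsLattice K M`,
i.e. `K · M = D`, is strictly weaker when `K ≠ ℚ` and is *not* what is meant.) [folklore] -/
def IsFullLattice (M : Submodule ℤ D) : Prop :=
  M.FG ∧ ∀ d : D, ∃ n : ℤ, n ≠ 0 ∧ n • d ∈ M

/-- The **Jordan–Zassenhaus property** of a `ℤ`-order `Λ ⊆ D` (Swan–Evans, LNM 149, Ch. 3,
Definition before Lemma 3.7, specialised to full lattices in `A = D` itself): the full right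
`Λ`-lattices `M ⊆ D` (`M Λ ⊆ M`) lie in finitely many orbits under left multiplication by `Dˣ` —
there is a finite set `T` of lattices such that every such `M` is `d⁻¹ M'` with `d ∈ Dˣ`,
`M' ∈ T`. For full lattices in `D`, isomorphism classes of right `Λ`-modules are exactly these
orbits (an isomorphism extends to a right `D`-linear automorphism of `D`, i.e. a left
multiplication). [cite: SwanEvans1970, Ch. 3, Definition before Lemma 3.7 and Thm. 3.9] -/
def HasFiniteClassSet (Λ : Submodule ℤ D) : Prop :=
  ∃ T : Finset (Submodule ℤ D), ∀ M : Submodule ℤ D, IsFullLattice D M →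
    (∀ m ∈ M, ∀ a ∈ Λ, m * a ∈ M) → ∃ d : Dˣ, d • M ∈ T

variable {D}

/-- Membership in a translate `d • M` of a `ℤ`-submodule by a unit `d ∈ Dˣ` (acting by left
multiplication): `m ∈ d M ↔ d⁻¹ m ∈ M`. [folklore] -/
theorem mem_units_smul_submodule_iff {d : Dˣ} {M : Submodule ℤ D} {m : D} :
    m ∈ d • M ↔ (d⁻¹ : Dˣ) • m ∈ M := by
  rw [Units.smul_def, Submodule.mem_smul_pointwise_iff_exists]
  constructor
  · rintro ⟨s, hs, rfl⟩
    rwa [← Units.smul_def, inv_smul_smul]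
  · intro h
    exact ⟨_, h, by rw [← Units.smul_def, smul_inv_smul]⟩

section Window

variable [IsAddTorsionFree D]

/-- A finitely generated `ℤ`-submodule `N` of a torsion-free group has finite quotient `N / nN`
for `n ≠ 0`; phrased with the relative index of any `P ⊇ n N`. [folklore] -/
theorem relIndex_ne_zero_of_smul_mem (N : Submodule ℤ D) (hN : N.FG) {n : ℤ} (hn : n ≠ 0)
    (P : Submodule ℤ D) (hP : ∀ x ∈ N, n • x ∈ P) :
    P.toAddSubgroup.relIndex N.toAddSubgroup ≠ 0 := by
  haveI : Module.Finite ℤ N := Module.Finite.iff_fg.mpr hN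
  let f : N →ₗ[ℤ] N := DistribSMul.toLinearMap ℤ N n
  have hf : Function.Injective f := fun x y hxy =>
    smul_right_injective N hn (by simpa [f] using hxy)
  let W : Submodule ℤ N := LinearMap.range f
  haveI hQ : Finite (N ⧸ W) := by
    refine Submodule.finiteQuotientOfFreeOfRankEq W ?_
    exact (LinearEquiv.ofInjective f hf).finrank_eq.symm
  haveI : Finite (N ⧸ W.toAddSubgroup) := hQ
  have hW : W.toAddSubgroup.index ≠ 0 := AddSubgroup.index_ne_zero_of_finite
  have hle : W.toAddSubgroup ≤ P.toAddSubgroup.addSubgroupOf N.toAddSubgroup := by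
    rintro x ⟨y, rfl⟩
    exact hP y y.2
  intro h0
  apply hW
  have hdvd := AddSubgroup.index_dvd_of_le hle
  rw [AddSubgroup.relIndex] at h0
  rw [h0] at hdvd
  exact Nat.eq_zero_of_zero_dvd hdvd

/-- **Window finiteness**: finitely many `P` with `n N ⊆ P ⊆ N`. [cite: SwanEvans1970, Ch. 3 Lemma 3.11 (proof: Λ M / t Λ M finite)] -/
theorem finite_setOf_le_and_smul_mem (N : Submodule ℤ D) (hN : N.FG) {n : ℤ} (hn : n ≠ 0) :
    {P : Submodule ℤ D | P ≤ N ∧ ∀ x ∈ N, n • x ∈ P}.Finite := by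
  classical
  haveI : Module.Finite ℤ N := Module.Finite.iff_fg.mpr hN
  let f : N →ₗ[ℤ] N := DistribSMul.toLinearMap ℤ N n
  have hf : Function.Injective f := fun x y hxy =>
    smul_right_injective N hn (by simpa [f] using hxy)
  let W : Submodule ℤ N := LinearMap.range f
  haveI hQ : Finite (N ⧸ W) := by
    refine Submodule.finiteQuotientOfFreeOfRankEq W ?_
    exact (LinearEquiv.ofInjective f hf).finrank_eq.symm
  let g : Submodule ℤ D → Set (N ⧸ W) := fun P => W.mkQ '' (P.comap N.subtype : Set N)
  refine Set.Finite.of_finite_image (Set.toFinite _) (f := g) fun P hP P' hP' hPP' => ?_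
  have key : ∀ Q : Submodule ℤ D, Q ≤ N → (∀ x ∈ N, n • x ∈ Q) →
      Subtype.val '' (W.mkQ ⁻¹' (g Q)) = (Q : Set D) := by
    intro Q hQN hQn
    have hsat : W.mkQ ⁻¹' (g Q) = (Q.comap N.subtype : Set N) := by
      ext x
      constructor
      · rintro ⟨y, hy, hyx⟩
        have hxy : x - y ∈ W := by
          rw [← Submodule.Quotient.eq]
          exact hyx.symm
        obtain ⟨z, hz⟩ := hxy
        have : x = f z + y := by rw [hz, sub_add_cancel]
        rw [this]
        exact add_mem (hQn z z.2) hy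
      · intro hx
        exact ⟨x, hx, rfl⟩
    rw [hsat]
    ext d
    constructor
    · rintro ⟨x, hx, rfl⟩
      exact hx
    · intro hd
      exact ⟨⟨d, hQN hd⟩, hd, rfl⟩
  have := key P hP.1 hP.2
  rw [hPP', key P' hP'.1 hP'.2] at this
  exact SetLike.coe_injective this.symm

omit [IsAddTorsionFree D] in
/-- A full lattice `Λ` absorbs any finitely generated `Λ₀`: `n Λ₀ ⊆ Λ` for some `n ≠ 0`. [folklore] -/
theorem exists_smul_mem_of_fg {Λ Λ₀ : Submodule ℤ D} (hΛ : IsFullLattice D Λ) (hΛ₀ : Λ₀.FG) :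
    ∃ n : ℤ, n ≠ 0 ∧ ∀ a ∈ Λ₀, n • a ∈ Λ := by
  classical
  obtain ⟨s, hs⟩ := hΛ₀
  choose k hk hks using fun a : D => hΛ.2 a
  refine ⟨∏ a ∈ s, k a, Finset.prod_ne_zero_iff.mpr fun a _ => hk a, fun a ha => ?_⟩
  rw [← hs] at ha
  refine Submodule.span_induction (fun x hx => ?_) (by simp) (fun x y _ _ hx hy => ?_)
    (fun m x _ hx => ?_) ha
  · rw [← Finset.prod_erase_mul _ _ hx, mul_smul]
    exact Submodule.smul_mem _ _ (hks x)
  · rw [smul_add]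
    exact add_mem hx hy
  · rw [smul_comm]
    exact Submodule.smul_mem _ _ hx

end Window

/-! ### The division algebra case (Swan–Evans Thm. 3.9, last step) -/

section Division

/-- A characteristic-zero ring in which every nonzero element is a unit is torsion-free as an
additive group. [folklore] -/
theorem isAddTorsionFree_of_forall_isUnit [CharZero D] (hdiv : ∀ x : D, x ≠ 0 → IsUnit x) :
    IsAddTorsionFree D := by
  refine ⟨fun n hn a b hab => ?_⟩
  have h : (n : D) * (a - b) = 0 := by
    rw [mul_sub, ← nsmul_eq_mul, ← nsmul_eq_mul]
    exact sub_eq_zero.mpr hab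
  have hn' : (n : D) ≠ 0 := Nat.cast_ne_zero.mpr hn
  obtain ⟨u, hu⟩ := hdiv _ hn'
  rw [← hu] at h
  have : a - b = 0 := by
    have := congrArg (fun x => (u⁻¹ : Dˣ) • x) h
    simpa only [Units.smul_def, smul_eq_mul, Units.inv_mul_cancel_left, mul_zero] using this
  exact sub_eq_zero.mp this

variable {Λ : Submodule ℤ D}

/-- Left multiplication by elements of a multiplicatively closed `Λ`, as a `ℤ`-bilinear map
`Λ → Λ → Λ`. [folklore] -/
def mulLeftₗ (hmul : ∀ a ∈ Λ, ∀ b ∈ Λ, a * b ∈ Λ) : Λ →ₗ[ℤ] Λ →ₗ[ℤ] Λ :=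
  LinearMap.mk₂ ℤ (fun z x => ⟨(z : D) * x, hmul _ z.2 _ x.2⟩)
    (fun _ _ _ => Subtype.ext (add_mul _ _ _))
    (fun _ _ _ => Subtype.ext (smul_mul_assoc _ _ _))
    (fun _ _ _ => Subtype.ext (mul_add _ _ _))
    (fun _ _ _ => Subtype.ext (mul_smul_comm _ _ _))

/-- `mulLeftₗ z x = z x` in `D`. [folklore] -/
@[simp] theorem coe_mulLeftₗ (hmul : ∀ a ∈ Λ, ∀ b ∈ Λ, a * b ∈ Λ) (z x : Λ) :
    (mulLeftₗ hmul z x : D) = z * x := rfl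

/-- Left multiplication by a unit is injective on `Λ`. [folklore] -/
theorem mulLeftₗ_injective (hmul : ∀ a ∈ Λ, ∀ b ∈ Λ, a * b ∈ Λ) {z : Λ} (hz : IsUnit (z : D)) :
    Function.Injective (mulLeftₗ hmul z) := by
  intro x y hxy
  have h := congrArg (fun t : Λ => (t : D)) hxy
  simp only [coe_mulLeftₗ] at h
  exact Subtype.ext (hz.mul_left_cancel h)

/-- The range of left multiplication by `z` on `Λ`, pushed to `D`, is `z • Λ`. [folklore] -/
theorem map_subtype_range_mulLeftₗ (hmul : ∀ a ∈ Λ, ∀ b ∈ Λ, a * b ∈ Λ) (z : Λ) :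
    (LinearMap.range (mulLeftₗ hmul z)).map Λ.subtype = (z : D) • Λ := by
  ext d
  simp only [Submodule.mem_map, LinearMap.mem_range, Submodule.mem_smul_pointwise_iff_exists,
    smul_eq_mul]
  constructor
  · rintro ⟨_, ⟨x, rfl⟩, rfl⟩
    exact ⟨x, x.2, rfl⟩
  · rintro ⟨b, hb, rfl⟩
    exact ⟨⟨z * b, hmul _ z.2 _ hb⟩, ⟨⟨b, hb⟩, rfl⟩, rfl⟩

/-- `[Λ : z Λ] = |det (x ↦ z x)|` for `z ∈ Λ` a unit of `D`. [folklore] -/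
theorem relIndex_smul_eq_natAbs_det [IsAddTorsionFree D] (hfg : Λ.FG)
    (hmul : ∀ a ∈ Λ, ∀ b ∈ Λ, a * b ∈ Λ) {z : Λ} (hz : IsUnit (z : D)) :
    ((z : D) • Λ).toAddSubgroup.relIndex Λ.toAddSubgroup =
      (LinearMap.det (mulLeftₗ hmul z)).natAbs := by
  haveI : Module.Finite ℤ Λ := Module.Finite.iff_fg.mpr hfg
  haveI : IsAddTorsionFree Λ := Λ.toAddSubgroup.instIsAddTorsionFree
  let N : Submodule ℤ Λ := LinearMap.range (mulLeftₗ hmul z)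
  let e : Λ ≃ₗ[ℤ] N := LinearEquiv.ofInjective _ (mulLeftₗ_injective hmul hz)
  have hdet := Submodule.natAbs_det_equiv N e
  have hcomp : N.subtype ∘ₗ AddMonoidHom.toIntLinearMap (e : Λ →+ N) = mulLeftₗ hmul z := by
    ext x
    rfl
  rw [hcomp] at hdet
  rw [hdet]
  -- identify the two quotients
  have hN : ((z : D) • Λ).toAddSubgroup.addSubgroupOf Λ.toAddSubgroup = N.toAddSubgroup := by
    ext x
    simp only [AddSubgroup.mem_addSubgroupOf, Submodule.mem_toAddSubgroup]
    rw [← map_subtype_range_mulLeftₗ hmul z]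
    simp only [Submodule.mem_map, Submodule.coe_subtype]
    constructor
    · rintro ⟨y, hy, hyx⟩
      rwa [← Subtype.ext hyx]
    · intro hx
      exact ⟨x, hx, rfl⟩
  rw [AddSubgroup.relIndex, hN, AddSubgroup.index]
  rfl


/-- **Polynomial bound for the norm form** (Swan–Evans, proof of Thm. 3.9, property (3)): in a
`ℤ`-basis `b` of `Λ`, `|det (x ↦ z x)| ≤ C · y ^ n` whenever all coordinates of `z` are `≤ y` in
absolute value. [cite: SwanEvans1970, Ch. 3 Thm. 3.9 (proof, property (3))] -/
theorem exists_bound_natAbs_det {ι : Type*} [Fintype ι] [DecidableEq ι] (b : Module.Basis ι ℤ Λ)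
    (hmul : ∀ a ∈ Λ, ∀ b ∈ Λ, a * b ∈ Λ) :
    ∃ C : ℕ, ∀ (z : Λ) (y : ℕ), (∀ i, |b.repr z i| ≤ y) →
      (LinearMap.det (mulLeftₗ hmul z)).natAbs ≤ C * y ^ Fintype.card ι := by
  classical
  set A : ι → Matrix ι ι ℤ := fun k => LinearMap.toMatrix b b (mulLeftₗ hmul (b k)) with hA
  set C₀ : ℤ := ∑ k, ∑ i, ∑ j, |A k i j| with hC₀
  have hnn1 : ∀ k i, 0 ≤ ∑ j, |A k i j| := fun k i =>
    Finset.sum_nonneg fun _ _ => abs_nonneg _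
  have hnn2 : ∀ k, 0 ≤ ∑ i, ∑ j, |A k i j| := fun k => Finset.sum_nonneg fun i _ => hnn1 k i
  have hC₀nonneg : 0 ≤ C₀ := Finset.sum_nonneg fun k _ => hnn2 k
  have hentry : ∀ k i j, |A k i j| ≤ C₀ := by
    intro k i j
    calc |A k i j| ≤ ∑ j, |A k i j| :=
          Finset.single_le_sum (f := fun j => |A k i j|) (fun _ _ => abs_nonneg _) (Finset.mem_univ j)
      _ ≤ ∑ i, ∑ j, |A k i j| :=
          Finset.single_le_sum (f := fun i => ∑ j, |A k i j|) (fun i _ => hnn1 k i)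
            (Finset.mem_univ i)
      _ ≤ C₀ :=
          Finset.single_le_sum (f := fun k => ∑ i, ∑ j, |A k i j|) (fun k _ => hnn2 k)
            (Finset.mem_univ k)
  refine ⟨(Fintype.card ι).factorial * (Fintype.card ι * C₀.toNat) ^ Fintype.card ι, ?_⟩
  intro z y hy
  have hz : mulLeftₗ hmul z = ∑ k, b.repr z k • mulLeftₗ hmul (b k) := by
    conv_lhs => rw [← b.sum_repr z]
    simp only [map_sum, map_zsmul]
  have hmat : LinearMap.toMatrix b b (mulLeftₗ hmul z) = ∑ k, b.repr z k • A k := by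
    rw [hz, map_sum]
    simp only [map_zsmul, hA]
  have hdet : LinearMap.det (mulLeftₗ hmul z) = (∑ k, b.repr z k • A k).det := by
    rw [← hmat, LinearMap.det_toMatrix]
  have hbound := Matrix.det_sum_smul_le (abv := AbsoluteValue.abs) Finset.univ
    (c := fun k => b.repr z k) (A := A) (x := C₀) (y := (y : ℤ))
    (fun k i j => by rw [AbsoluteValue.abs_apply]; exact hentry k i j)
    (fun k => by rw [AbsoluteValue.abs_apply]; exact hy k)
  rw [AbsoluteValue.abs_apply, Finset.card_univ] at hbound
  have h1 : ((LinearMap.det (mulLeftₗ hmul z)).natAbs : ℤ) ≤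
      (Fintype.card ι).factorial • ((Fintype.card ι) • (y : ℤ) * C₀) ^ Fintype.card ι := by
    rw [Int.natCast_natAbs, hdet]
    exact hbound
  have h2 : ((Fintype.card ι).factorial • ((Fintype.card ι) • (y : ℤ) * C₀) ^ Fintype.card ι : ℤ) =
      (((Fintype.card ι).factorial * (Fintype.card ι * C₀.toNat) ^ Fintype.card ι *
        y ^ Fintype.card ι : ℕ) : ℤ) := by
    have : (C₀.toNat : ℤ) = C₀ := Int.toNat_of_nonneg hC₀nonneg
    push_cast
    rw [this, nsmul_eq_mul, nsmul_eq_mul]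
    ring
  rw [h2] at h1
  exact_mod_cast h1

/-- The rank of a `ℤ`-order is positive. [folklore] -/
theorem card_pos_of_one_mem [Nontrivial D] {ι : Type*} [Fintype ι] (b : Module.Basis ι ℤ Λ)
    (h1 : (1 : D) ∈ Λ) : 0 < Fintype.card ι := by
  by_contra h
  have h0 : Fintype.card ι = 0 := by omega
  haveI : IsEmpty ι := Fintype.card_eq_zero_iff.mp h0
  have hsub : ∀ x : Λ, x = 0 := fun x => by
    apply b.repr.injective
    ext i
    exact isEmptyElim i
  have := congrArg (fun t : Λ => (t : D)) (hsub ⟨1, h1⟩)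
  exact one_ne_zero (this : (1 : D) = 0)

/-- **The core of the division algebra case** (Swan–Evans Thm. 3.9, last step): every full right
`Λ`-lattice `M ⊆ Λ` can be moved by a unit of `D` into the window `r Λ ⊆ · ⊆ Λ`, `r = C!`. [cite: SwanEvans1970, Ch. 3 Thm. 3.9 (proof, last step) and Lemma 3.13] -/
theorem exists_units_smul_mem_window [CharZero D] (hdiv : ∀ x : D, x ≠ 0 → IsUnit x)
    {ι : Type*} [Fintype ι] [DecidableEq ι] (b : Module.Basis ι ℤ Λ) (h1 : (1 : D) ∈ Λ)
    (hmul : ∀ a ∈ Λ, ∀ b ∈ Λ, a * b ∈ Λ) (hΛ : IsFullLattice D Λ) {C : ℕ}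
    (hC : ∀ (z : Λ) (y : ℕ), (∀ i, |b.repr z i| ≤ y) →
      (LinearMap.det (mulLeftₗ hmul z)).natAbs ≤ C * y ^ Fintype.card ι)
    {M : Submodule ℤ D} (hM : IsFullLattice D M) (hMΛ : ∀ m ∈ M, ∀ a ∈ Λ, m * a ∈ M)
    (hle : M ≤ Λ) :
    ∃ d : Dˣ, d • M ≤ Λ ∧ ∀ x ∈ Λ, (C.factorial : ℤ) • x ∈ d • M := by
  classical
  haveI : IsAddTorsionFree D := isAddTorsionFree_of_forall_isUnit hdiv
  set n := Fintype.card ι with hn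
  have hnpos : 0 < n := card_pos_of_one_mem b h1
  -- (a) the index `m = [Λ : M]` is finite and positive
  set m := M.toAddSubgroup.relIndex Λ.toAddSubgroup with hm
  have hm0 : m ≠ 0 := by
    obtain ⟨t, ht0, ht⟩ := exists_smul_mem_of_fg hM hΛ.1
    exact relIndex_ne_zero_of_smul_mem Λ hΛ.1 ht0 M ht
  -- (b) `k ^ n ≤ m < (k + 1) ^ n`
  set k := Nat.findGreatest (fun k => k ^ n ≤ m) m with hk
  have hk1 : k ^ n ≤ m := by
    have := Nat.findGreatest_spec (P := fun k => k ^ n ≤ m) (m := 1) (Nat.one_le_iff_ne_zero.mpr hm0)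
      (by simpa using Nat.one_le_iff_ne_zero.mpr hm0)
    simpa [hk] using this
  have hk2 : m < (k + 1) ^ n := by
    by_cases hkm : k + 1 ≤ m
    · have := Nat.findGreatest_is_greatest (P := fun k => k ^ n ≤ m) (Nat.lt_succ_self k) hkm
      simpa using this
    · push Not at hkm
      calc m < k + 1 := hkm
        _ ≤ (k + 1) ^ n := Nat.le_self_pow hnpos.ne' _
  have hkpos : 0 < k := by
    by_contra h0
    have : k = 0 := by omega
    rw [this, zero_add, one_pow] at hk2
    omega
  -- (c) pigeonhole: a nonzero `z ∈ M` with coordinates bounded by `k`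
  let M' : Submodule ℤ Λ := M.comap Λ.subtype
  have hM' : M'.toAddSubgroup = M.toAddSubgroup.addSubgroupOf Λ.toAddSubgroup := by
    ext x
    rfl
  have hcardQ : Nat.card (Λ ⧸ M') = m := by
    rw [hm, AddSubgroup.relIndex, ← hM', AddSubgroup.index]
    rfl
  haveI : Finite (Λ ⧸ M') := Nat.finite_of_card_ne_zero (hcardQ ▸ hm0)
  letI : Fintype (Λ ⧸ M') := Fintype.ofFinite _
  let box : Finset (ι → ℕ) := Fintype.piFinset fun _ => Finset.range (k + 1)
  have hbox : box.card = (k + 1) ^ n := by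
    rw [Fintype.card_piFinset, Finset.prod_const, Finset.card_range, Finset.card_univ]
  let v : (ι → ℕ) → Λ := fun x => b.equivFun.symm fun i => (x i : ℤ)
  let f : (ι → ℕ) → Λ ⧸ M' := fun x => Submodule.Quotient.mk (v x)
  have hlt : (Finset.univ : Finset (Λ ⧸ M')).card < box.card := by
    rw [hbox, Finset.card_univ, ← Nat.card_eq_fintype_card, hcardQ]
    exact hk2
  obtain ⟨x, hx, x', hx', hxx', hfx⟩ :=
    Finset.exists_ne_map_eq_of_card_lt_of_maps_to hlt (f := f) fun _ _ => Finset.mem_univ _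
  set z : Λ := v x - v x' with hzdef
  have hzM : (z : D) ∈ M := by
    have : v x - v x' ∈ M' := (Submodule.Quotient.eq M').mp hfx
    exact this
  have hzrepr : ∀ i, b.repr z i = (x i : ℤ) - x' i := by
    intro i
    rw [hzdef]
    simp only [v, map_sub, Finsupp.coe_sub, Pi.sub_apply]
    rw [← b.equivFun_apply, ← b.equivFun_apply, LinearEquiv.apply_symm_apply,
      LinearEquiv.apply_symm_apply]
  have hz0 : (z : D) ≠ 0 := by
    intro h
    have hz' : z = 0 := Subtype.ext h
    apply hxx'
    funext i
    have := hzrepr i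
    rw [hz', map_zero, Finsupp.coe_zero, Pi.zero_apply] at this
    omega
  have hzk : ∀ i, |b.repr z i| ≤ (k : ℤ) := by
    intro i
    rw [hzrepr i]
    have h₁ : x i < k + 1 := Finset.mem_range.mp (Fintype.mem_piFinset.mp hx i)
    have h₂ : x' i < k + 1 := Finset.mem_range.mp (Fintype.mem_piFinset.mp hx' i)
    rw [abs_sub_le_iff]
    constructor <;> omega
  -- (d) `z` is a unit; `z Λ ⊆ M ⊆ Λ` with `[Λ : zΛ] ≤ C k ^ n`
  have hzu : IsUnit (z : D) := hdiv _ hz0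
  set zu : Dˣ := hzu.unit with hzudef
  have hzucoe : (zu : D) = z := hzu.unit_spec
  set zΛ : Submodule ℤ D := (z : D) • Λ with hzΛ
  have hzΛM : zΛ ≤ M := by
    intro d hd
    obtain ⟨l, hl, rfl⟩ := (Submodule.mem_smul_pointwise_iff_exists _ _ _).mp hd
    exact hMΛ _ hzM _ hl
  have hidx : zΛ.toAddSubgroup.relIndex Λ.toAddSubgroup ≤ C * k ^ n := by
    rw [hzΛ, relIndex_smul_eq_natAbs_det hΛ.1 hmul hzu]
    exact hC z k hzk
  have hidx0 : zΛ.toAddSubgroup.relIndex Λ.toAddSubgroup ≠ 0 := by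
    obtain ⟨t, ht0, ht⟩ := hΛ.2 (zu⁻¹ : Dˣ)
    refine relIndex_ne_zero_of_smul_mem Λ hΛ.1 ht0 zΛ fun y hy => ?_
    rw [hzΛ, Submodule.mem_smul_pointwise_iff_exists]
    refine ⟨(t • ((zu⁻¹ : Dˣ) : D)) * y, hmul _ ht _ hy, ?_⟩
    rw [smul_eq_mul, smul_mul_assoc, mul_smul_comm, ← mul_assoc, ← hzucoe, Units.mul_inv,
      one_mul]
  -- (e) `j = [M : zΛ] ≤ C`
  set j := zΛ.toAddSubgroup.relIndex M.toAddSubgroup with hj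
  have hjm : j * m = zΛ.toAddSubgroup.relIndex Λ.toAddSubgroup :=
    AddSubgroup.relIndex_mul_relIndex _ _ _ (fun _ h => hzΛM h) (fun _ h => hle h)
  have hj0 : j ≠ 0 := by
    intro h
    rw [h, zero_mul] at hjm
    exact hidx0 hjm.symm
  have hjC : j ≤ C := by
    have h3 : j * k ^ n ≤ C * k ^ n :=
      calc j * k ^ n ≤ j * m := Nat.mul_le_mul_left _ hk1
        _ ≤ C * k ^ n := hjm ▸ hidx
    exact Nat.le_of_mul_le_mul_right h3 (Nat.pow_pos hkpos)
  -- (f) `N = z⁻¹ M ⊇ Λ` with `[N : Λ] = j`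
  set N : Submodule ℤ D := ((zu⁻¹ : Dˣ) : D) • M with hN
  have hΛN : Λ ≤ N := by
    intro y hy
    rw [hN, Submodule.mem_smul_pointwise_iff_exists]
    refine ⟨(z : D) * y, hMΛ _ hzM _ hy, ?_⟩
    rw [smul_eq_mul, ← mul_assoc, ← hzucoe, Units.inv_mul, one_mul]
  let φ : D →+ D := AddMonoidHom.mulLeft ((zu⁻¹ : Dˣ) : D)
  have hφ : Function.Injective φ := fun a a' h => by
    simpa [φ] using h
  have hmapM : M.toAddSubgroup.map φ = N.toAddSubgroup := by
    ext y
    simp only [AddSubgroup.mem_map, Submodule.mem_toAddSubgroup, hN,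
      Submodule.mem_smul_pointwise_iff_exists, φ, AddMonoidHom.coe_mulLeft, smul_eq_mul]
  have hmapzΛ : zΛ.toAddSubgroup.map φ = Λ.toAddSubgroup := by
    ext y
    simp only [AddSubgroup.mem_map, Submodule.mem_toAddSubgroup, hzΛ,
      Submodule.mem_smul_pointwise_iff_exists, φ, AddMonoidHom.coe_mulLeft, smul_eq_mul]
    constructor
    · rintro ⟨_, ⟨l, hl, rfl⟩, rfl⟩
      rwa [← mul_assoc, ← hzucoe, Units.inv_mul, one_mul]
    · intro hy
      refine ⟨z * y, ⟨y, hy, rfl⟩, ?_⟩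
      rw [← mul_assoc, ← hzucoe, Units.inv_mul, one_mul]
  have hjN : Λ.toAddSubgroup.relIndex N.toAddSubgroup = j := by
    rw [← hmapM, ← hmapzΛ, AddSubgroup.relIndex_map_map_of_injective _ _ hφ]
  -- (g) `r = C!` kills `N / Λ`
  have hrN : ∀ y ∈ N, (C.factorial : ℕ) • y ∈ Λ := by
    intro y hy
    have h := AddSubgroup.nsmul_mem_of_relIndex_ne_zero_of_dvd (H := Λ.toAddSubgroup)
      (K := N.toAddSubgroup) (hjN ▸ hj0) hy (n := C.factorial) fun m' hm'0 hm'le =>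
        Nat.dvd_factorial hm'0 (hm'le.trans (hjN ▸ hjC))
    exact h.1
  -- (h) the unit `d = r z⁻¹`
  have hr0 : ((C.factorial : ℕ) : D) ≠ 0 := Nat.cast_ne_zero.mpr (Nat.factorial_ne_zero C)
  have hru : IsUnit ((C.factorial : ℕ) : D) := hdiv _ hr0
  refine ⟨hru.unit * zu⁻¹, ?_, ?_⟩
  · intro y hy
    rw [Units.smul_def, Submodule.mem_smul_pointwise_iff_exists] at hy
    obtain ⟨m₀, hm₀, rfl⟩ := hy
    rw [Units.val_mul, hru.unit_spec, smul_eq_mul, mul_assoc, ← nsmul_eq_mul]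
    exact hrN _ (Submodule.smul_mem_pointwise_smul _ _ _ hm₀)
  · intro y hy
    obtain ⟨m₀, hm₀, hm₀y⟩ := (Submodule.mem_smul_pointwise_iff_exists _ _ _).mp (hΛN hy)
    rw [Units.smul_def, Submodule.mem_smul_pointwise_iff_exists]
    refine ⟨m₀, hm₀, ?_⟩
    rw [Units.val_mul, hru.unit_spec, smul_eq_mul, mul_assoc, ← smul_eq_mul _ m₀, hm₀y,
      ← nsmul_eq_mul, natCast_zsmul]

/-- **Jordan–Zassenhaus for orders in division algebras** (Swan–Evans, LNM 149, Thm. 3.9, last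
step of the proof, for `R = ℤ`): if every nonzero element of the characteristic-zero ring `D`
is a unit and `Λ ⊆ D` is a `ℤ`-order which is a full lattice, the full right `Λ`-lattices in
`D` lie in finitely many `Dˣ`-orbits. [cite: SwanEvans1970, Ch. 3 Thm. 3.9 (proof, division algebra case, R = ℤ)] -/
theorem hasFiniteClassSet_of_forall_isUnit [CharZero D] (hdiv : ∀ x : D, x ≠ 0 → IsUnit x)
    (h1 : (1 : D) ∈ Λ) (hmul : ∀ a ∈ Λ, ∀ b ∈ Λ, a * b ∈ Λ) (hΛ : IsFullLattice D Λ) :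
    HasFiniteClassSet D Λ := by
  classical
  haveI : IsAddTorsionFree D := isAddTorsionFree_of_forall_isUnit hdiv
  haveI : Module.Finite ℤ Λ := Module.Finite.iff_fg.mpr hΛ.1
  haveI : IsAddTorsionFree Λ := Λ.toAddSubgroup.instIsAddTorsionFree
  let b := Module.Free.chooseBasis ℤ Λ
  obtain ⟨C, hC⟩ := exists_bound_natAbs_det b hmul
  have hr : (C.factorial : ℤ) ≠ 0 := by exact_mod_cast Nat.factorial_ne_zero C
  refine ⟨(finite_setOf_le_and_smul_mem Λ hΛ.1 hr).toFinset, fun M hM hMΛ => ?_⟩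
  -- scale `M` into `Λ`
  obtain ⟨t, ht0, ht⟩ := exists_smul_mem_of_fg hΛ hM.1
  have htu : IsUnit ((t : ℤ) : D) := hdiv _ (Int.cast_ne_zero.mpr ht0)
  set M₁ : Submodule ℤ D := htu.unit • M with hM₁
  have hmemM₁ : ∀ {y : D}, y ∈ M₁ ↔ ∃ m₀ ∈ M, t • m₀ = y := by
    intro y
    rw [hM₁, Units.smul_def, htu.unit_spec, Submodule.mem_smul_pointwise_iff_exists]
    simp only [smul_eq_mul, zsmul_eq_mul]
  have hM₁le : M₁ ≤ Λ := by
    intro y hy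
    obtain ⟨m₀, hm₀, rfl⟩ := hmemM₁.mp hy
    exact ht _ hm₀
  have hM₁full : IsFullLattice D M₁ := by
    refine ⟨?_, fun d => ?_⟩
    · rw [hM₁, Units.smul_def]
      exact hM.1.map _
    · obtain ⟨n₀, hn₀, hn₀d⟩ := hM.2 d
      refine ⟨t * n₀, mul_ne_zero ht0 hn₀, hmemM₁.mpr ⟨n₀ • d, hn₀d, ?_⟩⟩
      rw [mul_smul]
  have hM₁Λ : ∀ m ∈ M₁, ∀ a ∈ Λ, m * a ∈ M₁ := by
    intro m hm a ha
    obtain ⟨m₀, hm₀, rfl⟩ := hmemM₁.mp hm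
    exact hmemM₁.mpr ⟨m₀ * a, hMΛ _ hm₀ _ ha, (smul_mul_assoc _ _ _).symm⟩
  obtain ⟨d, hd1, hd2⟩ :=
    exists_units_smul_mem_window hdiv b h1 hmul hΛ hC hM₁full hM₁Λ hM₁le
  refine ⟨d * htu.unit, ?_⟩
  rw [Set.Finite.mem_toFinset, Set.mem_setOf_eq, mul_smul, ← hM₁]
  exact ⟨hd1, hd2⟩

end Division


section ChangeOfOrder

/-- Monotonicity in the order: a bigger order has fewer lattices. [folklore] -/
theorem HasFiniteClassSet.mono {Γ Λ : Submodule ℤ D} (h : Γ ≤ Λ) (hΓ : HasFiniteClassSet D Γ) :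
    HasFiniteClassSet D Λ := by
  obtain ⟨T, hT⟩ := hΓ
  exact ⟨T, fun M hM hMΛ => hT M hM fun m hm a ha => hMΛ m hm a (h ha)⟩

/-- `n (M Λ) ⊆ M` when `n Λ ⊆ Γ` and `M Γ ⊆ M`. [folklore] -/
theorem smul_mem_of_mem_mul {Γ Λ M : Submodule ℤ D} {n : ℤ} (hnΛ : ∀ a ∈ Λ, n • a ∈ Γ)
    (hMΓ : ∀ m ∈ M, ∀ a ∈ Γ, m * a ∈ M) {x : D} (hx : x ∈ M * Λ) : n • x ∈ M := by
  refine Submodule.mul_induction_on hx (fun m hm a ha => ?_) (fun x y hx hy => ?_)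
  · rw [← mul_smul_comm]
    exact hMΓ m hm _ (hnΛ a ha)
  · rw [smul_add]
    exact add_mem hx hy

/-- `M Λ` is right `Λ`-stable when `Λ` is multiplicatively closed. [folklore] -/
theorem mul_mem_mul_of_mem_mul {Λ M : Submodule ℤ D} (hmul : ∀ a ∈ Λ, ∀ b ∈ Λ, a * b ∈ Λ) {m : D}
    (hm : m ∈ M * Λ) {a : D} (ha : a ∈ Λ) : m * a ∈ M * Λ := by
  refine Submodule.mul_induction_on hm (fun m hm b hb => ?_) (fun x y hx hy => ?_)
  · rw [mul_assoc]
    exact Submodule.mul_mem_mul hm (hmul b hb a ha)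
  · rw [add_mul]
    exact add_mem hx hy

variable [IsAddTorsionFree D]

/-- **Change of order** (Swan–Evans, LNM 149, Lemma 3.11): if `n Λ ⊆ Γ` for some `n ≠ 0`
(with `Λ` a `ℤ`-order), and the full right `Λ`-lattices fall into finitely many `Dˣ`-orbits,
then so do the full right `Γ`-lattices: `M ↦ M Λ` lands in a `Λ`-orbit `d⁻¹ N`, and
`n N ⊆ d M ⊆ N` leaves finitely many possibilities. [cite: SwanEvans1970, Ch. 3 Lemma 3.11] -/
theorem HasFiniteClassSet.of_smul_mem {Γ Λ : Submodule ℤ D} (h1 : (1 : D) ∈ Λ)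
    (hmul : ∀ a ∈ Λ, ∀ b ∈ Λ, a * b ∈ Λ) (hΛfg : Λ.FG) {n : ℤ} (hn : n ≠ 0)
    (hnΛ : ∀ a ∈ Λ, n • a ∈ Γ) (hΛ : HasFiniteClassSet D Λ) : HasFiniteClassSet D Γ := by
  classical
  obtain ⟨T, hT⟩ := hΛ
  let win : Submodule ℤ D → Finset (Submodule ℤ D) := fun N =>
    if h : N.FG then (finite_setOf_le_and_smul_mem N h hn).toFinset else ∅
  refine ⟨T.biUnion win, fun M hM hMΓ => ?_⟩
  -- `M' = M Λ` is a full right `Λ`-lattice containing `M`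
  have hMM' : M ≤ M * Λ := fun m hm => by simpa using Submodule.mul_mem_mul hm h1
  have hM' : IsFullLattice D (M * Λ) := by
    refine ⟨hM.1.mul hΛfg, fun d => ?_⟩
    obtain ⟨k, hk, hkd⟩ := hM.2 d
    exact ⟨k, hk, hMM' hkd⟩
  obtain ⟨d, hd⟩ := hT (M * Λ) hM' fun m hm a ha => mul_mem_mul_of_mem_mul hmul hm ha
  have hNfg : (d • (M * Λ)).FG := by
    change (Submodule.map _ (M * Λ)).FG
    exact hM'.1.map _
  refine ⟨d, Finset.mem_biUnion.mpr ⟨d • (M * Λ), hd, ?_⟩⟩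
  simp only [win, dif_pos hNfg, Set.Finite.mem_toFinset, Set.mem_setOf_eq]
  constructor
  · intro x hx
    rw [mem_units_smul_submodule_iff] at hx ⊢
    exact hMM' hx
  · intro x hx
    rw [mem_units_smul_submodule_iff] at hx ⊢
    rw [smul_comm]
    exact smul_mem_of_mem_mul hnΛ hMΓ hx

/-- **Change of order, combined form** (Swan–Evans Lemma 3.11): if `Λ₀` is a `ℤ`-order with the
Jordan–Zassenhaus property and `n Λ₀ ⊆ Λ` for some `n ≠ 0`, then `Λ ∩ Λ₀` and hence `Λ` have
the property. [cite: SwanEvans1970, Ch. 3 Lemma 3.11] -/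
theorem HasFiniteClassSet.of_order {Λ Λ₀ : Submodule ℤ D} (h1 : (1 : D) ∈ Λ₀)
    (hmul : ∀ a ∈ Λ₀, ∀ b ∈ Λ₀, a * b ∈ Λ₀) (hΛ₀fg : Λ₀.FG) {n : ℤ} (hn : n ≠ 0)
    (hnΛ : ∀ a ∈ Λ₀, n • a ∈ Λ) (hΛ₀ : HasFiniteClassSet D Λ₀) : HasFiniteClassSet D Λ :=
  HasFiniteClassSet.mono (inf_le_left : Λ ⊓ Λ₀ ≤ Λ)
    (HasFiniteClassSet.of_smul_mem h1 hmul hΛ₀fg hn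
      (fun a ha => ⟨hnΛ a ha, Submodule.smul_mem _ n ha⟩) hΛ₀)

end ChangeOfOrder

/-! ### The split case `M₂(K)`: Morita reduction to lattices in `K²` and Steinitz classes -/

section Split

variable (R : Type*) [CommRing R] (K : Type*) [Field K] [Algebra R K]

local notation "Mat" => Matrix (Fin 2) (Fin 2) K

/-- The order `M₂(R) ⊆ M₂(K)`, as a `ℤ`-submodule. [folklore] -/
def matrixOrder : Submodule ℤ Mat where
  carrier := {A | ∀ i j, A i j ∈ (algebraMap R K).range}
  add_mem' ha hb i j := by
    rw [Matrix.add_apply]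
    exact add_mem (ha i j) (hb i j)
  zero_mem' i j := zero_mem _
  smul_mem' n A hA i j := by
    rw [Matrix.smul_apply]
    exact zsmul_mem (hA i j) n

variable {R K}

/-- Membership in `M₂(R)`: all entries integral (definitional). [folklore] -/
theorem mem_matrixOrder_iff {A : Mat} :
    A ∈ matrixOrder R K ↔ ∀ i j, A i j ∈ (algebraMap R K).range := Iff.rfl

/-- `1 ∈ M₂(R)`. [folklore] -/
theorem one_mem_matrixOrder : (1 : Mat) ∈ matrixOrder R K := by
  intro i j
  rw [Matrix.one_apply]
  split_ifs
  · exact one_mem _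
  · exact zero_mem _

/-- `M₂(R)` is multiplicatively closed. [folklore] -/
theorem mul_mem_matrixOrder {A B : Mat} (hA : A ∈ matrixOrder R K) (hB : B ∈ matrixOrder R K) :
    A * B ∈ matrixOrder R K := by
  intro i j
  rw [Matrix.mul_apply]
  exact sum_mem fun l _ => mul_mem (hA i l) (hB l j)

/-- Scalar matrices `r · 1`, `r ∈ R`, lie in `M₂(R)`. [folklore] -/
theorem algebraMap_mem_matrixOrder (r : R) : algebraMap R Mat r ∈ matrixOrder R K := by
  intro i j
  rw [Matrix.algebraMap_matrix_apply]
  split_ifs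
  · exact ⟨r, rfl⟩
  · exact zero_mem _

/-- The matrix with first column `v` and second column `0`. [folklore] -/
def colEmb (v : Fin 2 → K) : Mat := Matrix.of fun i j => if j = 0 then v i else 0

/-- Entries of `colEmb v` (definitional). [folklore] -/
@[simp] theorem colEmb_apply (v : Fin 2 → K) (i j : Fin 2) :
    colEmb v i j = if j = 0 then v i else 0 := rfl

/-- The elementary matrix `E j` (`1` at `(j, 0)`): `A * E j` has first column the `j`-th column
of `A`, second column `0`. [folklore] -/
def colPick (j : Fin 2) : Mat := Matrix.of fun i' j' => if i' = j ∧ j' = 0 then 1 else 0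

/-- The elementary matrix `F j` (`1` at `(0, j)`): `colEmb v * F j` has `j`-th column `v`, other
column `0`. [folklore] -/
def colPut (j : Fin 2) : Mat := Matrix.of fun i' j' => if i' = 0 ∧ j' = j then 1 else 0

/-- The elementary matrices `E j` lie in `M₂(R)`. [folklore] -/
theorem colPick_mem (j : Fin 2) : colPick j ∈ matrixOrder R K := by
  intro i' j'
  simp only [colPick, Matrix.of_apply]
  split_ifs
  · exact one_mem _
  · exact zero_mem _

/-- The elementary matrices `F j` lie in `M₂(R)`. [folklore] -/
theorem colPut_mem (j : Fin 2) : colPut j ∈ matrixOrder R K := by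
  intro i' j'
  simp only [colPut, Matrix.of_apply]
  split_ifs
  · exact one_mem _
  · exact zero_mem _

/-- `A · E j = [A_j | 0]` extracts the `j`-th column. [folklore] -/
theorem mul_colPick (A : Mat) (j : Fin 2) : A * colPick j = colEmb fun i => A i j := by
  ext i j'
  simp only [Matrix.mul_apply, colPick, Matrix.of_apply, colEmb_apply, Fin.sum_univ_two]
  fin_cases j <;> fin_cases j' <;> simp

/-- `A = Σ_j [A_j | 0] · F j`: a matrix is recovered from its columns. [folklore] -/
theorem eq_sum_colEmb_mul_colPut (A : Mat) :
    A = colEmb (fun i => A i 0) * colPut 0 + colEmb (fun i => A i 1) * colPut 1 := by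
  ext i j'
  simp only [Matrix.add_apply, Matrix.mul_apply, colPut, Matrix.of_apply, colEmb_apply,
    Fin.sum_univ_two]
  fin_cases j' <;> simp

/-- `[r v | 0] = [v | 0] · (r · 1)` for `r ∈ R`. [folklore] -/
theorem colEmb_smul (r : R) (v : Fin 2 → K) :
    colEmb (r • v) = colEmb v * algebraMap R Mat r := by
  ext i j'
  rw [Matrix.algebraMap_eq_diagonal, Matrix.mul_diagonal]
  simp only [colEmb_apply, Pi.algebraMap_apply, Algebra.smul_def]
  split_ifs
  · exact mul_comm _ _
  · exact (zero_mul _).symm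

/-- `colEmb` is additive. [folklore] -/
theorem colEmb_add (v w : Fin 2 → K) : colEmb (v + w) = colEmb v + colEmb w := by
  ext i j'
  simp only [colEmb_apply, Matrix.add_apply, Pi.add_apply]
  split_ifs <;> simp

/-- `colEmb` commutes with integer multiples. [folklore] -/
theorem colEmb_zsmul (n : ℤ) (v : Fin 2 → K) : colEmb (n • v) = n • colEmb v := by
  ext i j'
  simp only [colEmb_apply, Matrix.smul_apply, Pi.smul_apply]
  split_ifs <;> simp

/-- The **column lattice** `P = {v ∈ K² | [v | 0] ∈ M}` of a right `M₂(R)`-stable `M ⊆ M₂(K)`. [folklore] -/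
def colLattice (M : Submodule ℤ Mat) (hM : ∀ m ∈ M, ∀ a ∈ matrixOrder R K, m * a ∈ M) :
    Submodule R (Fin 2 → K) where
  carrier := {v | colEmb v ∈ M}
  add_mem' {v w} hv hw := by
    change colEmb (v + w) ∈ M
    rw [colEmb_add]
    exact add_mem hv hw
  zero_mem' := by
    change colEmb 0 ∈ M
    have : colEmb (0 : Fin 2 → K) = 0 := by
      ext i j
      simp
    rw [this]
    exact zero_mem _
  smul_mem' r v hv := by
    change colEmb (r • v) ∈ M
    rw [colEmb_smul]
    exact hM _ hv _ (algebraMap_mem_matrixOrder r)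

/-- Membership in the column lattice (definitional). [folklore] -/
theorem mem_colLattice_iff {M : Submodule ℤ Mat}
    {hM : ∀ m ∈ M, ∀ a ∈ matrixOrder R K, m * a ∈ M} {v : Fin 2 → K} :
    v ∈ colLattice M hM ↔ colEmb v ∈ M := Iff.rfl

/-- **Morita, by hand**: `A ∈ M` iff every column of `A` lies in the column lattice. [folklore] -/
theorem mem_iff_forall_col_mem {M : Submodule ℤ Mat}
    (hM : ∀ m ∈ M, ∀ a ∈ matrixOrder R K, m * a ∈ M) {A : Mat} :
    A ∈ M ↔ ∀ j, (fun i => A i j) ∈ colLattice M hM := by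
  constructor
  · intro hA j
    rw [mem_colLattice_iff, ← mul_colPick]
    exact hM _ hA _ (colPick_mem j)
  · intro h
    rw [eq_sum_colEmb_mul_colPut A]
    exact add_mem (hM _ (h 0) _ (colPut_mem 0)) (hM _ (h 1) _ (colPut_mem 1))


/-! #### Fullness of `M₂(R)` and of the column lattice -/

/-- `M₂(R) ⊆ M₂(K)` is the image of `Matrix (Fin 2) (Fin 2) R`. [folklore] -/
theorem matrixOrder_eq_range :
    matrixOrder R K = LinearMap.range
      (((algebraMap R K).mapMatrix : Matrix (Fin 2) (Fin 2) R →+* Mat).toAddMonoidHom.toIntLinearMap) := by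
  ext A
  simp only [LinearMap.mem_range, AddMonoidHom.coe_toIntLinearMap, RingHom.toAddMonoidHom_eq_coe,
    AddMonoidHom.coe_coe, RingHom.mapMatrix_apply]
  constructor
  · intro hA
    choose B hB using fun i j => hA i j
    refine ⟨Matrix.of B, ?_⟩
    ext i j
    simp [hB]
  · rintro ⟨B, rfl⟩ i j
    exact ⟨B i j, rfl⟩

/-- `M₂(R)` is a finitely generated `ℤ`-module when `R` is. [folklore] -/
theorem matrixOrder_fg [Module.Finite ℤ R] : (matrixOrder R K).FG := by
  rw [matrixOrder_eq_range, LinearMap.range_eq_map]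
  haveI : Module.Finite ℤ (Matrix (Fin 2) (Fin 2) R) :=
    inferInstanceAs (Module.Finite ℤ (Fin 2 → Fin 2 → R))
  exact Module.Finite.fg_top.map _

/-- `M₂(R)` is a full `ℤ`-lattice in `M₂(K)` when `R` is finite over `ℤ` and every element of
`K` has an integer multiple in `R`. [folklore] -/
theorem isFullLattice_matrixOrder [Module.Finite ℤ R]
    (hden : ∀ k : K, ∃ n : ℤ, n ≠ 0 ∧ n • k ∈ (algebraMap R K).range) :
    IsFullLattice Mat (matrixOrder R K) := by
  classical
  refine ⟨matrixOrder_fg, fun A => ?_⟩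
  choose n hn hnk using hden
  refine ⟨∏ ij : Fin 2 × Fin 2, n (A ij.1 ij.2),
    Finset.prod_ne_zero_iff.mpr fun ij _ => hn _, fun i j => ?_⟩
  rw [Matrix.smul_apply, ← Finset.prod_erase_mul _ _ (Finset.mem_univ (i, j)), mul_smul]
  exact zsmul_mem (hnk (A i j)) _

/-- The column lattice of a full lattice `M` is full: every `v ∈ K²` has a nonzero integer
multiple in it. [folklore] -/
theorem exists_zsmul_mem_colLattice {M : Submodule ℤ Mat}
    (hM : ∀ m ∈ M, ∀ a ∈ matrixOrder R K, m * a ∈ M) (hMfull : IsFullLattice Mat M) (v : Fin 2 → K) :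
    ∃ n : ℤ, n ≠ 0 ∧ n • v ∈ colLattice M hM := by
  obtain ⟨n, hn, hnv⟩ := hMfull.2 (colEmb v)
  refine ⟨n, hn, ?_⟩
  rw [mem_colLattice_iff, colEmb_zsmul]
  exact hnv

/-- The column lattice of a full lattice `M` has a common denominator `N ≠ 0`:
`N P ⊆ R²`. [folklore] -/
theorem exists_denominator_colLattice [Module.Finite ℤ R] {M : Submodule ℤ Mat}
    (hM : ∀ m ∈ M, ∀ a ∈ matrixOrder R K, m * a ∈ M)
    (hden : ∀ k : K, ∃ n : ℤ, n ≠ 0 ∧ n • k ∈ (algebraMap R K).range) (hMfull : IsFullLattice Mat M) :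
    ∃ N : ℤ, N ≠ 0 ∧ ∀ v ∈ colLattice M hM, ∀ i, N • v i ∈ (algebraMap R K).range := by
  obtain ⟨N, hN, hNM⟩ := exists_smul_mem_of_fg (isFullLattice_matrixOrder hden) hMfull.1
  refine ⟨N, hN, fun v hv i => ?_⟩
  have h := hNM _ hv i 0
  simpa [Matrix.smul_apply] using h

/-! #### The Steinitz decomposition of the column lattice -/

variable (R) in
/-- The second-coordinate ideal `𝔟 = {v 1 | v ∈ P} ⊆ K` of `P ⊆ K²` (coordinates indexed by
`Fin 2 = {0, 1}`). [folklore] -/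
abbrev sndIdeal (P : Submodule R (Fin 2 → K)) : Submodule R K :=
  P.map (LinearMap.proj 1 : (Fin 2 → K) →ₗ[R] K)

/-- Membership in the second-coordinate ideal. [folklore] -/
theorem mem_sndIdeal_iff {P : Submodule R (Fin 2 → K)} {y : K} :
    y ∈ sndIdeal R P ↔ ∃ v ∈ P, v 1 = y := by
  simp [sndIdeal, Submodule.mem_map]

section Dedekind

variable [IsDedekindDomain R] [IsFractionRing R K]

/-- A section of the second-coordinate projection `P → 𝔟`, from the invertibility of the
fractional ideal `𝔟` of the Dedekind domain `R` (`𝔟 𝔟⁻¹ = R`): the projectivity of `𝔟` made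
explicit. [folklore] -/
theorem exists_section (P : Submodule R (Fin 2 → K)) {N : R} (hN : N ≠ 0)
    (hPN : ∀ v ∈ P, ∀ i, N • v i ∈ (algebraMap R K).range)
    (hb : ∃ y ∈ sndIdeal R P, y ≠ 0) :
    ∃ s : sndIdeal R P →ₗ[R] P, ∀ y, ((s y : P) : Fin 2 → K) 1 = y := by
  have hfrac : IsFractional R⁰ (sndIdeal R P) := by
    refine ⟨N, mem_nonZeroDivisors_of_ne_zero hN, fun y hy => ?_⟩
    obtain ⟨v, hv, rfl⟩ := mem_sndIdeal_iff.mp hy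
    obtain ⟨r, hr⟩ := hPN v hv 1
    exact ⟨r, hr⟩
  set 𝔟F : FractionalIdeal R⁰ K := ⟨sndIdeal R P, hfrac⟩ with h𝔟F
  have hcoe : (𝔟F : Submodule R K) = sndIdeal R P := rfl
  have h𝔟F0 : 𝔟F ≠ 0 := by
    obtain ⟨y, hy, hy0⟩ := hb
    intro h
    exact hy0 ((FractionalIdeal.eq_zero_iff.mp h) y hy)
  have hone : (1 : K) ∈ (𝔟F : Submodule R K) * ((𝔟F⁻¹ : FractionalIdeal R⁰ K) : Submodule R K) := by
    rw [← FractionalIdeal.coe_mul, mul_inv_cancel₀ h𝔟F0, FractionalIdeal.coe_one]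
    exact Submodule.mem_one.mpr ⟨1, map_one _⟩
  have key : ∀ x ∈ (𝔟F : Submodule R K) * ((𝔟F⁻¹ : FractionalIdeal R⁰ K) : Submodule R K),
      ∃ φ : sndIdeal R P →ₗ[R] P, ∀ y : sndIdeal R P, ((φ y : P) : Fin 2 → K) 1 = x * y := by
    intro x hx
    refine Submodule.mul_induction_on hx ?_ ?_
    · intro b hb c hc
      rw [hcoe] at hb
      obtain ⟨p, hp, hpb⟩ := mem_sndIdeal_iff.mp hb
      have hcy : ∀ y ∈ sndIdeal R P, ∃ r : R, algebraMap R K r = c * y := fun y hy => by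
        have h : c * y ∈ ((𝔟F⁻¹ * 𝔟F : FractionalIdeal R⁰ K) : Submodule R K) := by
          rw [FractionalIdeal.coe_mul]
          exact Submodule.mul_mem_mul hc hy
        rw [inv_mul_cancel₀ h𝔟F0, FractionalIdeal.coe_one] at h
        exact Submodule.mem_one.mp h
      have hmem : ∀ y ∈ sndIdeal R P, (c * y) • p ∈ P := fun y hy => by
        obtain ⟨r, hr⟩ := hcy y hy
        rw [← hr, algebraMap_smul]
        exact P.smul_mem r hp
      refine ⟨{ toFun := fun y => ⟨(c * y) • p, hmem y y.2⟩
                map_add' := fun y y' => ?_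
                map_smul' := fun r y => ?_ }, fun y => ?_⟩
      · ext i
        simp only [Submodule.coe_add, Pi.add_apply, Pi.smul_apply, smul_eq_mul]
        ring
      · apply Subtype.ext
        funext i
        simp only [SetLike.val_smul, Pi.smul_apply, smul_eq_mul, RingHom.id_apply]
        simp only [Algebra.smul_def]
        ring
      · change ((c * (y : K)) • p) 1 = b * c * y
        rw [Pi.smul_apply, smul_eq_mul, hpb]
        ring
    · rintro x₁ x₂ ⟨φ₁, h₁⟩ ⟨φ₂, h₂⟩
      refine ⟨φ₁ + φ₂, fun y => ?_⟩
      rw [LinearMap.add_apply, Submodule.coe_add, Pi.add_apply, h₁, h₂, add_mul]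
  obtain ⟨s, hs⟩ := key 1 hone
  exact ⟨s, fun y => by rw [hs, one_mul]⟩

omit [IsDedekindDomain R] in
/-- The first coordinate of an `R`-linear section is multiplication by a constant `σ`. [folklore] -/
theorem exists_sigma (P : Submodule R (Fin 2 → K)) {N : R} (hN : N ≠ 0)
    (hPN : ∀ v ∈ P, ∀ i, N • v i ∈ (algebraMap R K).range)
    (s : sndIdeal R P →ₗ[R] P) :
    ∃ σ : K, ∀ y, ((s y : P) : Fin 2 → K) 0 = σ * y := by
  by_cases hb : ∃ b₀ ∈ sndIdeal R P, b₀ ≠ 0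
  · obtain ⟨b₀, hb₀, hb₀0⟩ := hb
    refine ⟨((s ⟨b₀, hb₀⟩ : P) : Fin 2 → K) 0 / b₀, fun y => ?_⟩
    have hNinj : (algebraMap R K N) ≠ 0 :=
      (map_ne_zero_iff _ (IsFractionRing.injective R K)).mpr hN
    -- denominators for `y` and `b₀`
    have hden : ∀ y ∈ sndIdeal R P, ∃ r : R, algebraMap R K r = N • y := fun y hy => by
      obtain ⟨v, hv, rfl⟩ := mem_sndIdeal_iff.mp hy
      obtain ⟨r, hr⟩ := hPN v hv 1
      exact ⟨r, hr⟩
    obtain ⟨r₁, hr₁⟩ := hden y y.2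
    obtain ⟨r₂, hr₂⟩ := hden b₀ hb₀
    have heq : r₂ • y = r₁ • (⟨b₀, hb₀⟩ : sndIdeal R P) := by
      apply Subtype.ext
      change r₂ • (y : K) = r₁ • b₀
      rw [Algebra.smul_def, Algebra.smul_def, hr₁, hr₂, smul_mul_assoc, smul_mul_assoc, mul_comm]
    have h2 := congrArg (fun w : sndIdeal R P => ((s w : P) : Fin 2 → K) 0) heq
    simp only [map_smul, SetLike.val_smul, Pi.smul_apply] at h2
    rw [Algebra.smul_def, Algebra.smul_def, hr₁, hr₂, smul_mul_assoc, smul_mul_assoc] at h2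
    have h3 : b₀ * ((s y : P) : Fin 2 → K) 0 = (y : K) * ((s ⟨b₀, hb₀⟩ : P) : Fin 2 → K) 0 := by
      have h2' : (algebraMap R K N) * (b₀ * ((s y : P) : Fin 2 → K) 0) =
          (algebraMap R K N) * ((y : K) * ((s ⟨b₀, hb₀⟩ : P) : Fin 2 → K) 0) := by
        rw [Algebra.smul_def, Algebra.smul_def] at h2
        simpa [mul_assoc] using h2
      exact mul_left_cancel₀ hNinj h2'
    field_simp
    linear_combination h3
  · push Not at hb
    refine ⟨0, fun y => ?_⟩
    have hy : y = 0 := Subtype.ext (hb y y.2)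
    rw [hy, map_zero, zero_mul]
    rfl

omit [IsDedekindDomain R] [IsFractionRing R K] in
/-- **Steinitz form of the column lattice**: `v ∈ P ↔ v₁ ∈ 𝔟 ∧ v₀ - σ v₁ ∈ 𝔞`. [folklore] -/
theorem mem_iff_coords (P : Submodule R (Fin 2 → K))
    (s : sndIdeal R P →ₗ[R] P) (hs : ∀ y, ((s y : P) : Fin 2 → K) 1 = y) {σ : K}
    (hσ : ∀ y, ((s y : P) : Fin 2 → K) 0 = σ * y) (v : Fin 2 → K) :
    v ∈ P ↔ v 1 ∈ sndIdeal R P ∧ Pi.single (M := fun _ => K) 0 (v 0 - σ * v 1) ∈ P := by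
  constructor
  · intro hv
    have h1 : v 1 ∈ sndIdeal R P := mem_sndIdeal_iff.mpr ⟨v, hv, rfl⟩
    refine ⟨h1, ?_⟩
    have hdiff : v - ((s ⟨v 1, h1⟩ : P) : Fin 2 → K) = Pi.single (M := fun _ => K) 0 (v 0 - σ * v 1) := by
      funext i
      fin_cases i
      · simp [hσ]
      · simp [hs]
    rw [← hdiff]
    exact sub_mem hv (s ⟨v 1, h1⟩).2
  · rintro ⟨h1, h0⟩
    have : v = Pi.single (M := fun _ => K) 0 (v 0 - σ * v 1) + ((s ⟨v 1, h1⟩ : P) : Fin 2 → K) := by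
      funext i
      fin_cases i
      · simp [hσ]
      · simp [hs]
    rw [this]
    exact add_mem h0 (s ⟨v 1, h1⟩).2

/-! #### Ideal classes -/

/-- A representative integral ideal of an ideal class. [folklore] -/
noncomputable def repIdeal (c : ClassGroup R) : (Ideal R)⁰ :=
  Classical.choose (ClassGroup.mk0_surjective c)

/-- `repIdeal c` represents the class `c`. [folklore] -/
theorem mk0_repIdeal (c : ClassGroup R) : ClassGroup.mk0 (repIdeal c) = c :=
  Classical.choose_spec (ClassGroup.mk0_surjective c)

/-- Every nonzero fractional `R`-submodule of `K` is `t · J_c` for the representative `J_c` of its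
class (finiteness of the class group is not used here). [folklore] -/
theorem exists_eq_smul_repIdeal (𝔞 : Submodule R K) (h0 : ∃ a ∈ 𝔞, a ≠ 0) {N : R} (hN : N ≠ 0)
    (hden : ∀ a ∈ 𝔞, N • a ∈ (algebraMap R K).range) :
    ∃ c : ClassGroup R, ∃ t : K, t ≠ 0 ∧
      ∀ a : K, a ∈ 𝔞 ↔ ∃ r ∈ (repIdeal c : Ideal R), a = t * algebraMap R K r := by
  have hinj := IsFractionRing.injective R K
  have hNK : algebraMap R K N ≠ 0 := (map_ne_zero_iff _ hinj).mpr hN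
  -- the integral ideal `I = N 𝔞`
  let I : Ideal R :=
    { carrier := {r | ∃ a ∈ 𝔞, N • a = algebraMap R K r}
      add_mem' := by
        rintro r r' ⟨a, ha, har⟩ ⟨a', ha', har'⟩
        exact ⟨a + a', add_mem ha ha', by rw [smul_add, har, har', map_add]⟩
      zero_mem' := ⟨0, zero_mem _, by rw [smul_zero, map_zero]⟩
      smul_mem' := by
        rintro x r ⟨a, ha, har⟩
        refine ⟨x • a, 𝔞.smul_mem x ha, ?_⟩
        rw [smul_comm, har, smul_eq_mul, map_mul, Algebra.smul_def] }
  have hmemI : ∀ r, r ∈ I ↔ ∃ a ∈ 𝔞, N • a = algebraMap R K r := fun r => Iff.rfl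
  obtain ⟨a₀, ha₀, ha₀0⟩ := h0
  obtain ⟨r₀, hr₀⟩ := hden a₀ ha₀
  have hr₀0 : r₀ ≠ 0 := by
    rintro rfl
    rw [map_zero, Algebra.smul_def] at hr₀
    exact mul_ne_zero hNK ha₀0 hr₀.symm
  have hI0 : I ≠ 0 := by
    intro h
    have : r₀ ∈ I := ⟨a₀, ha₀, hr₀.symm⟩
    rw [h] at this
    exact hr₀0 this
  let I' : (Ideal R)⁰ := ⟨I, mem_nonZeroDivisors_of_ne_zero hI0⟩
  set c := ClassGroup.mk0 I' with hc
  obtain ⟨x, y, hx, hy, hxy⟩ := ClassGroup.mk0_eq_mk0_iff.mp ((mk0_repIdeal c).symm ▸ hc)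
  have hxK : algebraMap R K x ≠ 0 := (map_ne_zero_iff _ hinj).mpr hx
  have hyK : algebraMap R K y ≠ 0 := (map_ne_zero_iff _ hinj).mpr hy
  refine ⟨c, algebraMap R K x / (algebraMap R K N * algebraMap R K y),
    div_ne_zero hxK (mul_ne_zero hNK hyK), fun a => ⟨fun ha => ?_, ?_⟩⟩
  · obtain ⟨r, hr⟩ := hden a ha
    have hrI : r ∈ I := ⟨a, ha, hr.symm⟩
    have : y * r ∈ Ideal.span {x} * (repIdeal c : Ideal R) := by
      rw [hxy]
      exact Ideal.mem_span_singleton_mul.mpr ⟨r, hrI, rfl⟩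
    obtain ⟨r', hr', hxr'⟩ := Ideal.mem_span_singleton_mul.mp this
    refine ⟨r', hr', ?_⟩
    have h1 : algebraMap R K N * a = algebraMap R K r := by rw [hr, Algebra.smul_def]
    have h2 : algebraMap R K x * algebraMap R K r' = algebraMap R K y * algebraMap R K r := by
      rw [← map_mul, ← map_mul, hxr']
    have key : a * (algebraMap R K N * algebraMap R K y) = algebraMap R K x * algebraMap R K r' := by
      linear_combination (algebraMap R K y) * h1 - h2
    rw [div_mul_eq_mul_div, eq_div_iff (mul_ne_zero hNK hyK), key]
  · rintro ⟨r', hr', rfl⟩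
    have : x * r' ∈ Ideal.span {y} * I := by
      rw [← hxy]
      exact Ideal.mem_span_singleton_mul.mpr ⟨r', hr', rfl⟩
    obtain ⟨r, hrI, hyr⟩ := Ideal.mem_span_singleton_mul.mp this
    obtain ⟨a', ha', har⟩ := (hmemI r).mp hrI
    have h1 : algebraMap R K N * a' = algebraMap R K r := by rw [← har, Algebra.smul_def]
    have h2 : algebraMap R K y * algebraMap R K r = algebraMap R K x * algebraMap R K r' := by
      rw [← map_mul, ← map_mul, hyr]
    have key : algebraMap R K x / (algebraMap R K N * algebraMap R K y) * algebraMap R K r' = a' := by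
      rw [div_mul_eq_mul_div, div_eq_iff (mul_ne_zero hNK hyK)]
      linear_combination -h2 - (algebraMap R K y) * h1
    rw [key]
    exact ha'

/-- The lattice of matrices with first row in `J₁` and second row in `J₂`. [folklore] -/
def rowLattice (J₁ J₂ : Ideal R) : Submodule ℤ Mat where
  carrier := {A | (∀ j, A 0 j ∈ Submodule.map (Algebra.linearMap R K) J₁) ∧
    (∀ j, A 1 j ∈ Submodule.map (Algebra.linearMap R K) J₂)}
  add_mem' ha hb := ⟨fun j => add_mem (ha.1 j) (hb.1 j), fun j => add_mem (ha.2 j) (hb.2 j)⟩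
  zero_mem' := ⟨fun _ => zero_mem _, fun _ => zero_mem _⟩
  smul_mem' n A hA := ⟨fun j => by simpa using zsmul_mem (hA.1 j) n,
    fun j => by simpa using zsmul_mem (hA.2 j) n⟩

omit [IsDedekindDomain R] [IsFractionRing R K] in
/-- Membership in `rowLattice J₁ J₂` (definitional). [folklore] -/
theorem mem_rowLattice_iff {J₁ J₂ : Ideal R} {A : Mat} :
    A ∈ rowLattice J₁ J₂ ↔ (∀ j, A 0 j ∈ Submodule.map (Algebra.linearMap R K) J₁) ∧
      (∀ j, A 1 j ∈ Submodule.map (Algebra.linearMap R K) J₂) := Iff.rfl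

omit [IsDedekindDomain R] [IsFractionRing R K] in
/-- Membership in the image of an ideal of `R` in `K`. [folklore] -/
theorem mem_map_linearMap_iff {J : Ideal R} {a : K} :
    a ∈ Submodule.map (Algebra.linearMap R K) J ↔ ∃ r ∈ J, algebraMap R K r = a := by
  simp [Submodule.mem_map]

/-- **Jordan–Zassenhaus for `M₂(R)`**, `R` a Dedekind domain with finite class group whose
fraction field `K` has characteristic zero, `R` finite over `ℤ` with `K = ℚ R`: the full right
`M₂(R)`-lattices in `M₂(K)` lie in at most `h(R)²` orbits under `GL₂(K)` (Morita reduction to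
`R`-lattices `P ⊆ K²`, Steinitz form `P = g (J₁ ⊕ J₂)`; Swan–Evans Thm. 3.9, Morita step, and
Reiner, *Maximal Orders*, (26.4) with Steinitz's theorem). [cite: SwanEvans1970, Ch. 3 Thm. 3.9 (proof, Morita step)] [cite: Reiner2003MaximalOrders, §26 Thm. (26.4)] -/
theorem hasFiniteClassSet_matrixOrder [CharZero K] [Finite (ClassGroup R)] [Module.Finite ℤ R]
    (hden : ∀ k : K, ∃ n : ℤ, n ≠ 0 ∧ n • k ∈ (algebraMap R K).range) :
    HasFiniteClassSet Mat (matrixOrder R K) := by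
  classical
  haveI : Fintype (ClassGroup R) := Fintype.ofFinite _
  refine ⟨Finset.univ.image fun cc : ClassGroup R × ClassGroup R =>
    rowLattice (K := K) (repIdeal cc.1 : Ideal R) (repIdeal cc.2 : Ideal R), fun M hMfull hM => ?_⟩
  have hinj := IsFractionRing.injective R K
  set P := colLattice M hM with hP
  -- denominators
  obtain ⟨Nz, hNz, hNzP⟩ := exists_denominator_colLattice hM hden hMfull
  set N : R := (Nz : R) with hNdef
  have hN : N ≠ 0 := by
    intro h
    apply hNz
    have : (algebraMap R K) (Nz : R) = 0 := by rw [← hNdef, h, map_zero]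
    rw [map_intCast] at this
    exact_mod_cast this
  have hPN : ∀ v ∈ P, ∀ i, N • v i ∈ (algebraMap R K).range := fun v hv i => by
    rw [hNdef, Int.cast_smul_eq_zsmul]
    exact hNzP v hv i
  -- nonvanishing of `𝔞` and `𝔟`
  have hb : ∃ y ∈ sndIdeal R P, y ≠ 0 := by
    obtain ⟨n, hn, hnv⟩ := exists_zsmul_mem_colLattice hM hMfull (Pi.single 1 1)
    refine ⟨n, mem_sndIdeal_iff.mpr ⟨_, hnv, by simp⟩, by exact_mod_cast hn⟩
  obtain ⟨s, hs⟩ := exists_section P hN hPN hb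
  obtain ⟨σ, hσ⟩ := exists_sigma P hN hPN s
  set 𝔞 : Submodule R K := P.comap (LinearMap.single R (fun _ : Fin 2 => K) 0) with h𝔞
  have hmem𝔞 : ∀ a, a ∈ 𝔞 ↔ Pi.single (M := fun _ => K) 0 a ∈ P := fun a => Iff.rfl
  have ha0 : ∃ a ∈ 𝔞, a ≠ 0 := by
    obtain ⟨n, hn, hnv⟩ := exists_zsmul_mem_colLattice hM hMfull (Pi.single 0 1)
    refine ⟨n, ?_, by exact_mod_cast hn⟩
    rw [hmem𝔞]
    convert hnv using 1
    funext i
    fin_cases i <;> simp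
  have hden𝔞 : ∀ a ∈ 𝔞, N • a ∈ (algebraMap R K).range := fun a ha => by
    have := hPN _ ((hmem𝔞 a).mp ha) 0
    simpa using this
  have hden𝔟 : ∀ y ∈ sndIdeal R P, N • y ∈ (algebraMap R K).range := fun y hy => by
    obtain ⟨v, hv, rfl⟩ := mem_sndIdeal_iff.mp hy
    exact hPN v hv 1
  obtain ⟨c₁, t₁, ht₁, h𝔞rep⟩ := exists_eq_smul_repIdeal 𝔞 ha0 hN hden𝔞
  obtain ⟨c₂, t₂, ht₂, h𝔟rep⟩ := exists_eq_smul_repIdeal _ hb hN hden𝔟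
  -- the change-of-basis matrix
  let g : Mat := !![t₁, σ * t₂; 0, t₂]
  let g' : Mat := !![t₁⁻¹, -σ * t₁⁻¹; 0, t₂⁻¹]
  have hgg' : g * g' = 1 := by
    ext i j
    fin_cases i <;> fin_cases j
    · simp [g, g', Matrix.mul_apply, Fin.sum_univ_two, ht₁]
    · simp [g, g', Matrix.mul_apply, Fin.sum_univ_two]
      field_simp
      ring
    · simp [g, g', Matrix.mul_apply, Fin.sum_univ_two]
    · simp [g, g', Matrix.mul_apply, Fin.sum_univ_two, ht₂]
  have hg'g : g' * g = 1 := by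
    ext i j
    fin_cases i <;> fin_cases j
    · simp [g, g', Matrix.mul_apply, Fin.sum_univ_two, ht₁]
    · simp [g, g', Matrix.mul_apply, Fin.sum_univ_two]
      field_simp
      ring
    · simp [g, g', Matrix.mul_apply, Fin.sum_univ_two]
    · simp [g, g', Matrix.mul_apply, Fin.sum_univ_two, ht₂]
  let u : Matˣ := ⟨g, g', hgg', hg'g⟩
  refine ⟨u⁻¹, Finset.mem_image.mpr ⟨(c₁, c₂), Finset.mem_univ _, ?_⟩⟩
  -- `u⁻¹ • M` is the representative lattice
  symm
  ext A
  rw [mem_units_smul_submodule_iff, inv_inv, Units.smul_def, smul_eq_mul,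
    mem_iff_forall_col_mem hM, mem_rowLattice_iff]
  have hcol : ∀ j, (fun i => ((u : Mat) * A) i j) ∈ P ↔
      A 0 j ∈ Submodule.map (Algebra.linearMap R K) (repIdeal c₁ : Ideal R) ∧
      A 1 j ∈ Submodule.map (Algebra.linearMap R K) (repIdeal c₂ : Ideal R) := by
    intro j
    rw [mem_iff_coords P s hs hσ, ← hmem𝔞, h𝔞rep, h𝔟rep, mem_map_linearMap_iff,
      mem_map_linearMap_iff]
    have e1 : ((u : Mat) * A) 1 j = t₂ * A 1 j := by
      simp [u, g, Matrix.mul_apply, Fin.sum_univ_two]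
    have e0 : ((u : Mat) * A) 0 j - σ * ((u : Mat) * A) 1 j = t₁ * A 0 j := by
      simp [u, g, Matrix.mul_apply, Fin.sum_univ_two]
      ring
    rw [e0, e1]
    constructor
    · rintro ⟨⟨r₂, hr₂, h₂⟩, ⟨r₁, hr₁, h₁⟩⟩
      exact ⟨⟨r₁, hr₁, (mul_left_cancel₀ ht₁ h₁).symm⟩, ⟨r₂, hr₂, (mul_left_cancel₀ ht₂ h₂).symm⟩⟩
    · rintro ⟨⟨r₁, hr₁, h₁⟩, ⟨r₂, hr₂, h₂⟩⟩
      exact ⟨⟨r₂, hr₂, by rw [h₂]⟩, ⟨r₁, hr₁, by rw [h₁]⟩⟩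
  constructor
  · intro h
    exact ⟨fun j => ((hcol j).mp (h j)).1, fun j => ((hcol j).mp (h j)).2⟩
  · intro h j
    exact (hcol j).mpr ⟨h.1 j, h.2 j⟩

end Dedekind

end Split


/-! ### Wedderburn dichotomy for quaternion algebras -/

section Dichotomy

/-- A `1 × 1` matrix over a division ring with nonzero entry is a unit. [folklore] -/
theorem isUnit_of_ne_zero_matrix_fin_one {D' : Type*} [DivisionRing D'] (M : Matrix (Fin 1) (Fin 1) D')
    (hM : M ≠ 0) : IsUnit M := by
  have h00 : M 0 0 ≠ 0 := by
    intro h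
    apply hM
    ext i j
    rw [Subsingleton.elim i 0, Subsingleton.elim j 0, h]
    rfl
  refine ⟨⟨M, fun _ _ => (M 0 0)⁻¹, ?_, ?_⟩, rfl⟩
  · ext i j
    rw [Subsingleton.elim i 0, Subsingleton.elim j 0, Matrix.mul_apply, Fin.sum_univ_one,
      mul_inv_cancel₀ h00, Matrix.one_apply_eq]
  · ext i j
    rw [Subsingleton.elim i 0, Subsingleton.elim j 0, Matrix.mul_apply, Fin.sum_univ_one,
      inv_mul_cancel₀ h00, Matrix.one_apply_eq]

/-- **Wedderburn dichotomy for quaternion algebras**: a quaternion algebra is either a division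
algebra or isomorphic to `M₂(K)`. [folklore] -/
theorem forall_isUnit_or_nonempty_algEquiv_matrix (K : Type) [Field K] (D : Type u) [Ring D]
    [Algebra K D] [IsQuaternionAlgebra K D] :
    (∀ x : D, x ≠ 0 → IsUnit x) ∨ Nonempty (D ≃ₐ[K] Matrix (Fin 2) (Fin 2) K) := by
  haveI := IsQuaternionAlgebra.isSimpleRing' K D
  haveI : IsArtinianRing D := IsArtinianRing.of_finite K D
  obtain ⟨n, hn, D', _, _, _, ⟨e⟩⟩ := IsSimpleRing.exists_algEquiv_matrix_divisionRing_finite K D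
  have hdim : 4 = n * (n * Module.finrank K D') := by
    rw [← IsQuaternionAlgebra.finrank_eq_four (K := K) (D := D), e.toLinearEquiv.finrank_eq]
    change Module.finrank K (Fin n → Fin n → D') = _
    rw [Module.finrank_pi_fintype, Finset.sum_const, Finset.card_univ, Fintype.card_fin,
      smul_eq_mul, Module.finrank_pi_fintype, Finset.sum_const, Finset.card_univ, Fintype.card_fin,
      smul_eq_mul]
  have hf : 0 < Module.finrank K D' := Module.finrank_pos
  have hn0 : n ≠ 0 := hn.ne
  have hn2 : n ≤ 2 := by
    by_contra h
    have h3 : 3 ≤ n := by omega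
    have h9 : 9 ≤ n * n := by nlinarith
    have : n * n ≤ n * (n * Module.finrank K D') := by
      rw [← mul_assoc]
      exact Nat.le_mul_of_pos_right _ hf
    omega
  interval_cases n
  · exact (hn0 rfl).elim
  · -- `n = 1`: `D ≅ M₁(D')` is a division algebra
    left
    intro x hx
    have hex : e x ≠ 0 := by
      intro h
      exact hx (by simpa using congrArg e.symm h)
    have := (isUnit_of_ne_zero_matrix_fin_one (e x) hex).map e.symm
    simpa using this
  · -- `n = 2`: `finrank K D' = 1`, so `D' ≅ K` and `D ≅ M₂(K)`
    right
    have h1 : Module.finrank K D' = 1 := by omega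
    have hbij := (Algebra.finrank_eq_one_iff_bijective_algebraMap (F := K) (E := D')).mp h1
    let eK : D' ≃ₐ[K] K := (AlgEquiv.ofBijective (Algebra.ofId K D') hbij).symm
    exact ⟨e.trans eK.mapMatrix⟩


end Dichotomy

/-! ### Transport along ring isomorphisms -/

section Transport

variable {D : Type u} {D' : Type v} [Ring D] [Ring D']

/-- `HasFiniteClassSet` is invariant under ring isomorphisms. [folklore] -/
theorem HasFiniteClassSet.of_ringEquiv (e : D ≃+* D') {Λ : Submodule ℤ D} {Λ' : Submodule ℤ D'}
    (hΛ : ∀ x, x ∈ Λ ↔ e x ∈ Λ') (h : HasFiniteClassSet D' Λ') : HasFiniteClassSet D Λ := by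
  classical
  obtain ⟨T', hT'⟩ := h
  let ez : D →ₗ[ℤ] D' := (e.toRingHom.toAddMonoidHom).toIntLinearMap
  have hez : ∀ x, ez x = e x := fun x => rfl
  refine ⟨T'.image fun N' => N'.comap ez, fun M hM hMΛ => ?_⟩
  set M' : Submodule ℤ D' := M.map ez with hM'def
  have hmemM' : ∀ y, y ∈ M' ↔ e.symm y ∈ M := by
    intro y
    rw [hM'def, Submodule.mem_map]
    constructor
    · rintro ⟨x, hx, rfl⟩
      rwa [hez, RingEquiv.symm_apply_apply]
    · intro hy
      exact ⟨e.symm y, hy, by rw [hez, RingEquiv.apply_symm_apply]⟩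
  have hM' : IsFullLattice D' M' := by
    refine ⟨hM.1.map ez, fun d' => ?_⟩
    obtain ⟨n, hn, hnd⟩ := hM.2 (e.symm d')
    refine ⟨n, hn, (hmemM' _).mpr ?_⟩
    rwa [map_zsmul]
  have hM'Λ' : ∀ m' ∈ M', ∀ a' ∈ Λ', m' * a' ∈ M' := by
    intro m' hm' a' ha'
    rw [hmemM'] at hm' ⊢
    rw [map_mul]
    refine hMΛ _ hm' _ ((hΛ _).mpr ?_)
    rwa [RingEquiv.apply_symm_apply]
  obtain ⟨d', hd'⟩ := hT' M' hM' hM'Λ'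
  refine ⟨Units.map (e.symm : D' ≃+* D).toRingHom.toMonoidHom d',
    Finset.mem_image.mpr ⟨d' • M', hd', ?_⟩⟩
  ext x
  rw [Submodule.mem_comap, mem_units_smul_submodule_iff, mem_units_smul_submodule_iff, hmemM',
    Units.smul_def, Units.smul_def, smul_eq_mul, smul_eq_mul, map_mul, hez,
    RingEquiv.symm_apply_apply, Units.coe_map_inv]
  exact Iff.rfl

end Transport

/-! ### Assembly: the Jordan–Zassenhaus theorem for quaternion orders -/

section NumberField

open NumberField

/-- A vector space over a field of characteristic zero is torsion-free as an additive group.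
[folklore] -/
theorem isAddTorsionFree_of_charZero_module (K : Type*) (V : Type*) [Field K] [CharZero K]
    [AddCommGroup V] [Module K V] : IsAddTorsionFree V := by
  refine ⟨fun n hn a b h => ?_⟩
  have h' : (n : K) • a = (n : K) • b := by
    rwa [Nat.cast_smul_eq_nsmul, Nat.cast_smul_eq_nsmul]
  exact smul_right_injective V (Nat.cast_ne_zero.mpr hn) h'

/-- Every nonzero `c ∈ 𝓞_K` divides a nonzero rational integer (e.g. the absolute norm of `(c)`,
Mathlib `Ideal.absNorm_mem`). [folklore] -/
theorem exists_natCast_eq_mul {K : Type*} [Field K] [NumberField K] {c : 𝓞 K} (hc : c ≠ 0) :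
    ∃ n : ℕ, n ≠ 0 ∧ ∃ t : 𝓞 K, t * c = n := by
  refine ⟨Ideal.absNorm (Ideal.span {c}), ?_, Ideal.mem_span_singleton'.mp (Ideal.absNorm_mem _)⟩
  rw [Ne, Ideal.absNorm_eq_zero_iff, Ideal.span_singleton_eq_bot]
  exact hc

/-- Elements of a number field have `ℤ`-denominators with respect to `𝓞_K`. [folklore] -/
theorem exists_zsmul_mem_range (K : Type*) [Field K] [NumberField K] (k : K) :
    ∃ n : ℤ, n ≠ 0 ∧ n • k ∈ (algebraMap (𝓞 K) K).range := by
  obtain ⟨a, b, hb, rfl⟩ := IsFractionRing.div_surjective (A := 𝓞 K) k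
  have hb0 : b ≠ 0 := nonZeroDivisors.ne_zero hb
  obtain ⟨n, hn, t, ht⟩ := exists_natCast_eq_mul hb0
  have hbK : algebraMap (𝓞 K) K b ≠ 0 :=
    (map_ne_zero_iff _ (IsFractionRing.injective (𝓞 K) K)).mpr hb0
  refine ⟨n, Int.natCast_ne_zero.mpr hn, t * a, ?_⟩
  rw [map_mul, natCast_zsmul, nsmul_eq_mul, ← map_natCast (algebraMap (𝓞 K) K), ← ht, map_mul]
  field_simp

/-- **The Jordan–Zassenhaus theorem for `ℤ`-orders in quaternion algebras over number fields**
(Swan–Evans, LNM 149, Thm. 3.9 with Cor. 3.10 and Lemma 3.11), assembled from the division case,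
the split case and the change of order. [cite: SwanEvans1970, Ch. 3 Thm. 3.9, Cor. 3.10 and Lemma 3.11 (Jordan–Zassenhaus theorem)] -/
theorem hasFiniteClassSet_of_isQuaternionAlgebra (K : Type) [Field K] [NumberField K] (D : Type u)
    [Ring D] [Algebra K D] [IsQuaternionAlgebra K D] (Λ : Submodule ℤ D) (h1 : (1 : D) ∈ Λ)
    (hmul : ∀ a ∈ Λ, ∀ b ∈ Λ, a * b ∈ Λ) (hΛ : IsFullLattice D Λ) : HasFiniteClassSet D Λ := by
  haveI : Nontrivial D := Module.nontrivial_of_finrank_pos (R := K)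
    (by rw [IsQuaternionAlgebra.finrank_eq_four (K := K) (D := D)]; norm_num)
  rcases forall_isUnit_or_nonempty_algEquiv_matrix K D with hdiv | hsplit
  · haveI : CharZero D := charZero_of_injective_algebraMap (algebraMap K D).injective
    exact hasFiniteClassSet_of_forall_isUnit hdiv h1 hmul hΛ
  · obtain ⟨e⟩ := hsplit
    haveI : IsAddTorsionFree D := isAddTorsionFree_of_charZero_module K D
    have h0 : HasFiniteClassSet (Matrix (Fin 2) (Fin 2) K) (matrixOrder (𝓞 K) K) :=
      hasFiniteClassSet_matrixOrder (exists_zsmul_mem_range K)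
    let ezs : Matrix (Fin 2) (Fin 2) K →ₗ[ℤ] D :=
      (e.symm.toRingEquiv.toRingHom.toAddMonoidHom).toIntLinearMap
    have hezs : ∀ y, ezs y = e.symm y := fun _ => rfl
    set Λ₀ : Submodule ℤ D := (matrixOrder (𝓞 K) K).map ezs with hΛ₀def
    have hΛ₀ : ∀ x, x ∈ Λ₀ ↔ e x ∈ matrixOrder (𝓞 K) K := by
      intro x
      rw [hΛ₀def, Submodule.mem_map]
      constructor
      · rintro ⟨y, hy, rfl⟩
        rwa [hezs, AlgEquiv.apply_symm_apply]
      · intro hx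
        exact ⟨e x, hx, by rw [hezs, AlgEquiv.symm_apply_apply]⟩
    have hfin₀ : HasFiniteClassSet D Λ₀ :=
      HasFiniteClassSet.of_ringEquiv e.toRingEquiv (fun x => hΛ₀ x) h0
    have h1₀ : (1 : D) ∈ Λ₀ := by
      rw [hΛ₀, map_one]
      exact one_mem_matrixOrder
    have hmul₀ : ∀ a ∈ Λ₀, ∀ b ∈ Λ₀, a * b ∈ Λ₀ := fun a ha b hb => by
      rw [hΛ₀, map_mul]
      exact mul_mem_matrixOrder ((hΛ₀ a).mp ha) ((hΛ₀ b).mp hb)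
    have hfg₀ : Λ₀.FG := matrixOrder_fg.map _
    obtain ⟨n, hn, hnΛ⟩ := exists_smul_mem_of_fg hΛ hfg₀
    exact HasFiniteClassSet.of_order h1₀ hmul₀ hfg₀ hn hnΛ hfin₀

end NumberField


end Literature.NumberTheory.Automorphic
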